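import Literature.MathematicalPhysics.QuantumLattice.YangMillsHodgeDualField
import Literature.MathematicalPhysics.QuantumLattice.YangMillsHeatFlowBochner
import HarnessLib

/-!
# The covariant heat equation for the Hodge-dual field `u = ⋆(x ∧ F)` along the flow

QuantumLattice support file (everything proved; one definition, no named facts) on the proof
path of `Literature.MathematicalPhysics.QuantumLattice.Waldron2019_yangMillsFlow_flatTorus`
(A. Waldron, Invent. math. 217 (2019)), §4: along a solution of the Yang–Mills heat flow the
Hodge-dual sections `u_a = hodgeSec e (A t) a` (`YangMillsHodgeDualField`) satisfy the SAME
gauge-covariant heat equation as the curvature, componentwise,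
`∂ₜ u_a = ∑ᵢ Dᵢ Dᵢ u_a + N_a`, `N_a = ∑_{b,c,d} ε_{abcd} ⟨x,e_b⟩ ∑ᵢ [F(e_c,eᵢ), F(eᵢ,e_d)]`
(`hasDerivAt_hodgeSec_of_flow`): the extra first-order term `∑ᵢ ε_{aicd} DᵢF_{cd}` produced by
the factor `⟨x, e_b⟩` vanishes by the Bianchi identity (`sum_sum_sum_lc4_covDeriv_curvature`).

* `covDeriv_hodgeSec_frame` — `D_{eᵢ} u_a = ½∑_{c,d} ε_{aicd} F_{cd} + ½∑ ε_{abcd}⟨y,e_b⟩ DᵢF_{cd}`;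
* `covDeriv_covDeriv_hodgeSec_frame`, `sum_covDeriv_covDeriv_hodgeSec` —
  `∑ᵢ DᵢDᵢ u_a = ½ ∑ ε_{abcd} ⟨x,e_b⟩ ∑ᵢ DᵢDᵢF_{cd}`;
* `hodgeNonlin`, `hasDerivAt_hodgeSec_of_flow`.

References: A. Waldron, Invent. math. 217 (2019), §4.2 (system (4.2)(i)) [Waldron2019];
[folklore].
-/

noncomputable section

open scoped RealInnerProductSpace BigOperators ContDiff
open Set Literature.Analysis.InnerProduct

namespace Literature.MathematicalPhysics.QuantumLattice

section Heat

variable {E : Type*} [NormedAddCommGroup E] [InnerProductSpace ℝ E]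
variable {𝔸 : Type*} [NormedRing 𝔸] [NormedAlgebra ℝ 𝔸]

/-- `⟨e_i, e_b⟩ = δ_{ib}`. [folklore] -/
theorem obasis_inner_eq_ite (e : OrthonormalBasis (Fin 4) ℝ E) (i b : Fin 4) :
    ⟪e i, e b⟫ = if i = b then (1 : ℝ) else 0 :=
  orthonormal_iff_ite.1 e.orthonormal i b

/-- **First covariant derivative of `u_a` along a frame vector**, as a function of the point:
`D_{eᵢ} u_a(y) = ½∑_{c,d} ε_{aicd} F_{cd}(y) + ½∑_{b,c,d} ε_{abcd}⟨y,e_b⟩ DᵢF_{cd}(y)`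
(`A ∈ C²`). [folklore] -/
theorem covDeriv_hodgeSec_frame (e : OrthonormalBasis (Fin 4) ℝ E) {A : Connection E 𝔸}
    (hA : ContDiff ℝ 2 A) (a i : Fin 4) (y : E) :
    covDeriv A (hodgeSec e A a) y (e i) =
      (1 / 2 : ℝ) • ∑ c, ∑ d, ((lc4 a i c d : ℤ) : ℝ) • curvature A y (e c) (e d) +
        (1 / 2 : ℝ) • ∑ b, ∑ c, ∑ d, (((lc4 a b c d : ℤ) : ℝ) * ⟪y, e b⟫) •
          covDeriv A (fun z => curvature A z (e c) (e d)) y (e i) := by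
  rw [covDeriv_hodgeSec e hA a y (e i)]
  simp_rw [Finset.sum_add_distrib]
  rw [smul_add]
  congr 2
  -- `δ`-collapse of `∑_b ε_{abcd} ⟨e_i, e_b⟩`
  simp_rw [obasis_inner_eq_ite e i, mul_ite, mul_one, mul_zero, ite_smul, zero_smul]
  rw [Finset.sum_comm]
  refine Finset.sum_congr rfl fun c _ => ?_
  rw [Finset.sum_comm]
  refine Finset.sum_congr rfl fun d _ => ?_
  rw [Finset.sum_ite_eq, if_pos (Finset.mem_univ _)]

/-- **`∑_{i,c,d} ε_{aicd} T_{icd} = 0`** for `T_{icd} = DᵢF_{cd}` (Bianchi; the sign flip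
`ε_{aicd} = −ε_{iacd}` reduces it to `sum_lc4_smul_eq_zero_of_cyclic`). [folklore] -/
theorem sum_sum_sum_lc4_covDeriv_curvature (e : OrthonormalBasis (Fin 4) ℝ E)
    {A : Connection E 𝔸} (hA : ContDiff ℝ 2 A) (a : Fin 4) (x : E) :
    ∑ i, ∑ c, ∑ d, ((lc4 a i c d : ℤ) : ℝ) •
      covDeriv A (fun z => curvature A z (e c) (e d)) x (e i) = 0 := by
  have hT := sum_lc4_smul_eq_zero_of_cyclic
    (fun i c d => covDeriv A (fun z => curvature A z (e c) (e d)) x (e i))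
    (fun i c d => by
      rw [← covDeriv_fun_neg]
      congr 1
      funext z
      exact curvature_antisymm A z (e c) (e d))
    (fun i c d => covDeriv_curvature_cyclic_holds A hA x (e i) (e c) (e d)) a
  have heq : ∑ i, ∑ c, ∑ d, ((lc4 a i c d : ℤ) : ℝ) •
      covDeriv A (fun z => curvature A z (e c) (e d)) x (e i) =
      -∑ i, ∑ c, ∑ d, ((lc4 i a c d : ℤ) : ℝ) •
        covDeriv A (fun z => curvature A z (e c) (e d)) x (e i) := by
    rw [← Finset.sum_neg_distrib]
    refine Finset.sum_congr rfl fun i _ => ?_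
    rw [← Finset.sum_neg_distrib]
    refine Finset.sum_congr rfl fun c _ => ?_
    rw [← Finset.sum_neg_distrib]
    refine Finset.sum_congr rfl fun d _ => ?_
    rw [lc4_swap₁₂ i a c d, ← neg_smul]
    push_cast
    ring_nf
  rw [heq, hT, neg_zero]

/-- **Second covariant derivative of `u_a` along a frame vector** (`A ∈ C³`):
`Dᵢ(Dᵢu_a)(x) = ∑_{c,d} ε_{aicd} DᵢF_{cd}(x) + ½∑_{b,c,d} ε_{abcd}⟨x,e_b⟩ Dᵢ(DᵢF_{cd})(x)`.
[folklore] -/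
theorem covDeriv_covDeriv_hodgeSec_frame (e : OrthonormalBasis (Fin 4) ℝ E) {A : Connection E 𝔸}
    (hA : ContDiff ℝ 3 A) (a i : Fin 4) (x : E) :
    covDeriv A (fun y => covDeriv A (hodgeSec e A a) y (e i)) x (e i) =
      ∑ c, ∑ d, ((lc4 a i c d : ℤ) : ℝ) •
          covDeriv A (fun z => curvature A z (e c) (e d)) x (e i) +
        (1 / 2 : ℝ) • ∑ b, ∑ c, ∑ d, (((lc4 a b c d : ℤ) : ℝ) * ⟪x, e b⟫) •
          covDeriv A (fun y => covDeriv A (fun z => curvature A z (e c) (e d)) y (e i)) x (e i) := by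
  have hA2 : ContDiff ℝ 2 A := hA.of_le (by norm_num)
  have hA1 : ContDiff ℝ 1 A := hA.of_le (by norm_num)
  have hA21 : ContDiff ℝ ((2 : WithTop ℕ∞) + 1) A := by
    rw [show ((2 : WithTop ℕ∞) + 1) = 3 by norm_num]; exact hA
  have hF2 : ∀ c d, ContDiff ℝ 2 (fun z => curvature A z (e c) (e d)) := fun c d =>
    contDiff_curvature_apply (k := 2) hA21 (e c) (e d)
  have hFd : ∀ c d, DifferentiableAt ℝ (fun z => curvature A z (e c) (e d)) x := fun c d =>
    ((hF2 c d).differentiable two_ne_zero) x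
  have hDF1 : ∀ c d, ContDiff ℝ 1 (fun y => covDeriv A (fun z => curvature A z (e c) (e d)) y (e i)) :=
    fun c d => contDiff_covDeriv_apply (k := 1) hA1
      (by rw [show ((1 : WithTop ℕ∞) + 1) = 2 by norm_num]; exact hF2 c d) (e i)
  have hDFd : ∀ c d, DifferentiableAt ℝ
      (fun y => covDeriv A (fun z => curvature A z (e c) (e d)) y (e i)) x :=
    fun c d => ((hDF1 c d).differentiable one_ne_zero) x
  -- rewrite the inner function
  have hfun : (fun y => covDeriv A (hodgeSec e A a) y (e i)) = fun y =>
      (1 / 2 : ℝ) • ∑ c, ∑ d, ((lc4 a i c d : ℤ) : ℝ) • curvature A y (e c) (e d) +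
        (1 / 2 : ℝ) • ∑ b, ∑ c, ∑ d, (((lc4 a b c d : ℤ) : ℝ) * ⟪y, e b⟫) •
          covDeriv A (fun z => curvature A z (e c) (e d)) y (e i) :=
    funext fun y => covDeriv_hodgeSec_frame e hA2 a i y
  rw [hfun]
  -- differentiability of the pieces
  have hlin : ∀ b c d, DifferentiableAt ℝ (fun y : E => ((lc4 a b c d : ℤ) : ℝ) * ⟪y, e b⟫) x :=
    fun b c d => (differentiableAt_id.inner ℝ (differentiableAt_const (e b))).const_mul _
  have hdlin : ∀ b c d, fderiv ℝ (fun y : E => ((lc4 a b c d : ℤ) : ℝ) * ⟪y, e b⟫) x (e i) =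
      ((lc4 a b c d : ℤ) : ℝ) * (if i = b then 1 else 0) := by
    intro b c d
    have h : HasFDerivAt (fun y : E => ((lc4 a b c d : ℤ) : ℝ) * ⟪y, e b⟫)
        (((lc4 a b c d : ℤ) : ℝ) • (innerSL ℝ (e b) : E →L[ℝ] ℝ)) x := by
      have h1 : HasFDerivAt (fun y : E => ⟪y, e b⟫) (innerSL ℝ (e b) : E →L[ℝ] ℝ) x := by
        have := (innerSL ℝ (e b) : E →L[ℝ] ℝ).hasFDerivAt (x := x)
        simpa [innerSL_apply_apply, real_inner_comm] using this
      exact h1.const_mul _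
    rw [h.fderiv]
    simp [innerSL_apply_apply, real_inner_comm, obasis_inner_eq_ite e i b]
  have hP1 : ∀ c d, DifferentiableAt ℝ
      (fun y => ((lc4 a i c d : ℤ) : ℝ) • curvature A y (e c) (e d)) x :=
    fun c d => (hFd c d).fun_const_smul _
  have hP1c : ∀ c, DifferentiableAt ℝ
      (fun y => ∑ d, ((lc4 a i c d : ℤ) : ℝ) • curvature A y (e c) (e d)) x := fun c => by
    have := DifferentiableAt.fun_sum (u := Finset.univ) fun d _ => hP1 c d
    simpa using this
  have hP1s : DifferentiableAt ℝ
      (fun y => ∑ c, ∑ d, ((lc4 a i c d : ℤ) : ℝ) • curvature A y (e c) (e d)) x := by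
    have := DifferentiableAt.fun_sum (u := Finset.univ) fun c _ => hP1c c
    simpa using this
  have hP2 : ∀ b c d, DifferentiableAt ℝ (fun y => (((lc4 a b c d : ℤ) : ℝ) * ⟪y, e b⟫) •
      covDeriv A (fun z => curvature A z (e c) (e d)) y (e i)) x :=
    fun b c d => (hlin b c d).smul (hDFd c d)
  have hP2d : ∀ b c, DifferentiableAt ℝ (fun y => ∑ d, (((lc4 a b c d : ℤ) : ℝ) * ⟪y, e b⟫) •
      covDeriv A (fun z => curvature A z (e c) (e d)) y (e i)) x := fun b c => by
    have := DifferentiableAt.fun_sum (u := Finset.univ) fun d _ => hP2 b c d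
    simpa using this
  have hP2c : ∀ b, DifferentiableAt ℝ (fun y => ∑ c, ∑ d, (((lc4 a b c d : ℤ) : ℝ) * ⟪y, e b⟫) •
      covDeriv A (fun z => curvature A z (e c) (e d)) y (e i)) x := fun b => by
    have := DifferentiableAt.fun_sum (u := Finset.univ) fun c _ => hP2d b c
    simpa using this
  have hP2s : DifferentiableAt ℝ (fun y => ∑ b, ∑ c, ∑ d, (((lc4 a b c d : ℤ) : ℝ) * ⟪y, e b⟫) •
      covDeriv A (fun z => curvature A z (e c) (e d)) y (e i)) x := by
    have := DifferentiableAt.fun_sum (u := Finset.univ) fun b _ => hP2c b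
    simpa using this
  rw [covDeriv_fun_add A (hP1s.fun_const_smul _) (hP2s.fun_const_smul _)]
  -- first piece
  have hfirst : covDeriv A (fun y => (1 / 2 : ℝ) • ∑ c, ∑ d,
      ((lc4 a i c d : ℤ) : ℝ) • curvature A y (e c) (e d)) x (e i) =
      (1 / 2 : ℝ) • ∑ c, ∑ d, ((lc4 a i c d : ℤ) : ℝ) •
        covDeriv A (fun z => curvature A z (e c) (e d)) x (e i) := by
    rw [covDeriv_fun_smul A _ hP1s, covDeriv_fun_sum Finset.univ A (fun c _ => hP1c c)]
    congr 1
    refine Finset.sum_congr rfl fun c _ => ?_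
    rw [covDeriv_fun_sum Finset.univ A (fun d _ => hP1 c d)]
    refine Finset.sum_congr rfl fun d _ => ?_
    rw [covDeriv_fun_smul A _ (hFd c d)]
  -- second piece
  have hsecond : covDeriv A (fun y => (1 / 2 : ℝ) • ∑ b, ∑ c, ∑ d,
      (((lc4 a b c d : ℤ) : ℝ) * ⟪y, e b⟫) •
        covDeriv A (fun z => curvature A z (e c) (e d)) y (e i)) x (e i) =
      (1 / 2 : ℝ) • ∑ c, ∑ d, ((lc4 a i c d : ℤ) : ℝ) •
          covDeriv A (fun z => curvature A z (e c) (e d)) x (e i) +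
        (1 / 2 : ℝ) • ∑ b, ∑ c, ∑ d, (((lc4 a b c d : ℤ) : ℝ) * ⟪x, e b⟫) •
          covDeriv A (fun y => covDeriv A (fun z => curvature A z (e c) (e d)) y (e i)) x (e i) := by
    rw [covDeriv_fun_smul A _ hP2s, covDeriv_fun_sum Finset.univ A (fun b _ => hP2c b), ← smul_add]
    congr 1
    have hstep : ∀ b, covDeriv A (fun y => ∑ c, ∑ d, (((lc4 a b c d : ℤ) : ℝ) * ⟪y, e b⟫) •
        covDeriv A (fun z => curvature A z (e c) (e d)) y (e i)) x (e i) =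
        ∑ c, ∑ d, ((((lc4 a b c d : ℤ) : ℝ) * (if i = b then 1 else 0)) •
          covDeriv A (fun z => curvature A z (e c) (e d)) x (e i) +
          (((lc4 a b c d : ℤ) : ℝ) * ⟪x, e b⟫) •
            covDeriv A (fun y => covDeriv A (fun z => curvature A z (e c) (e d)) y (e i)) x (e i)) := by
      intro b
      rw [covDeriv_fun_sum Finset.univ A (fun c _ => hP2d b c)]
      refine Finset.sum_congr rfl fun c _ => ?_
      rw [covDeriv_fun_sum Finset.univ A (fun d _ => hP2 b c d)]
      refine Finset.sum_congr rfl fun d _ => ?_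
      rw [covDeriv_smul_fun A (hlin b c d) (hDFd c d), hdlin]
    simp_rw [hstep, Finset.sum_add_distrib]
    congr 1
    -- `δ`-collapse
    simp_rw [mul_ite, mul_one, mul_zero, ite_smul, zero_smul]
    rw [Finset.sum_comm]
    refine Finset.sum_congr rfl fun c _ => ?_
    rw [Finset.sum_comm]
    refine Finset.sum_congr rfl fun d _ => ?_
    rw [Finset.sum_ite_eq, if_pos (Finset.mem_univ _)]
  rw [hfirst, hsecond, ← add_assoc, ← two_smul ℝ, smul_smul]
  norm_num

/-- **`∑ᵢ DᵢDᵢ u_a = ½ ∑ ε_{abcd}⟨x,e_b⟩ ∑ᵢ DᵢDᵢ F_{cd}`** (`A ∈ C³`; the first-order terms cancel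
by Bianchi). [folklore] -/
theorem sum_covDeriv_covDeriv_hodgeSec (e : OrthonormalBasis (Fin 4) ℝ E) {A : Connection E 𝔸}
    (hA : ContDiff ℝ 3 A) (a : Fin 4) (x : E) :
    ∑ i, covDeriv A (fun y => covDeriv A (hodgeSec e A a) y (e i)) x (e i) =
      (1 / 2 : ℝ) • ∑ b, ∑ c, ∑ d, (((lc4 a b c d : ℤ) : ℝ) * ⟪x, e b⟫) •
        ∑ i, covDeriv A (fun y => covDeriv A (fun z => curvature A z (e c) (e d)) y (e i)) x (e i) := by
  simp_rw [covDeriv_covDeriv_hodgeSec_frame e hA a]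
  rw [Finset.sum_add_distrib, sum_sum_sum_lc4_covDeriv_curvature e (hA.of_le (by norm_num)) a x,
    zero_add, ← Finset.smul_sum]
  congr 1
  rw [Finset.sum_comm]
  refine Finset.sum_congr rfl fun b _ => ?_
  rw [Finset.sum_comm]
  refine Finset.sum_congr rfl fun c _ => ?_
  rw [Finset.sum_comm]
  refine Finset.sum_congr rfl fun d _ => ?_
  rw [Finset.smul_sum]

/-! ### Along the flow -/

/-- **The nonlinearity** `N_a = ∑_{b,c,d} ε_{abcd} ⟨x,e_b⟩ ∑ᵢ [F(e_c,eᵢ), F(eᵢ,e_d)]` of the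
`u`-equation (`= ⋆(x ∧ (F # F))`). [folklore] -/
def hodgeNonlin (e : OrthonormalBasis (Fin 4) ℝ E) (A : Connection E 𝔸) (a : Fin 4) (x : E) : 𝔸 :=
  ∑ b, ∑ c, ∑ d, (((lc4 a b c d : ℤ) : ℝ) * ⟪x, e b⟫) •
    ∑ i, ⁅curvature A x (e c) (e i), curvature A x (e i) (e d)⁆

variable [FiniteDimensional ℝ E]

/-- **The covariant heat equation for `u` along the Yang–Mills heat flow**: for `A` jointly
smooth on `𝒯 × E` solving `∂ₜA = div_A F` on the open time set `𝒯`, at `t ∈ 𝒯`,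
`∂ₜ u_a(x) = ∑ᵢ DᵢDᵢ u_a(x) + N_a(x)`. [folklore] -/
theorem hasDerivAt_hodgeSec_of_flow (e : OrthonormalBasis (Fin 4) ℝ E)
    {A : ℝ → Connection E 𝔸} {𝒯 : Set ℝ} (h𝒯 : IsOpen 𝒯)
    (hA : ContDiffOn ℝ ∞ (fun p : ℝ × E => A p.1 p.2) (𝒯 ×ˢ (univ : Set E)))
    (hpde : ∀ ⦃s : ℝ⦄, s ∈ 𝒯 → ∀ y w, deriv (fun s' => A s' y w) s = divCurvature (A s) y w)
    {t : ℝ} (ht : t ∈ 𝒯) (a : Fin 4) (x : E) :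
    HasDerivAt (fun s => hodgeSec e (A s) a x)
      (∑ i, covDeriv (A t) (fun y => covDeriv (A t) (hodgeSec e (A t) a) y (e i)) x (e i) +
        hodgeNonlin e (A t) a x) t := by
  have hsm : ContDiff ℝ ∞ (A t) := contDiff_slice_of_contDiffOn_prod hA ht
  have hA3 : ContDiff ℝ 3 (A t) := hsm.of_le ENat.LEInfty.out
  -- derivative of each curvature component
  have hF : ∀ c d, HasDerivAt (fun s => curvature (A s) x (e c) (e d))
      (∑ i, covDeriv (A t) (fun y => covDeriv (A t) (fun z => curvature (A t) z (e c) (e d)) y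
          (e i)) x (e i) +
        (2 : ℝ) • ∑ i, ⁅curvature (A t) x (e c) (e i), curvature (A t) x (e i) (e d)⁆) t :=
    fun c d => hasDerivAt_curvature_of_flow e h𝒯 hA hpde ht x (e c) (e d)
  -- assemble `u_a = ½ ∑ (ε x_b) • F_cd`
  have hterm : ∀ b c d, HasDerivAt
      (fun s => (((lc4 a b c d : ℤ) : ℝ) * ⟪x, e b⟫) • curvature (A s) x (e c) (e d))
      ((((lc4 a b c d : ℤ) : ℝ) * ⟪x, e b⟫) •
        (∑ i, covDeriv (A t) (fun y => covDeriv (A t) (fun z => curvature (A t) z (e c) (e d)) y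
            (e i)) x (e i) +
          (2 : ℝ) • ∑ i, ⁅curvature (A t) x (e c) (e i), curvature (A t) x (e i) (e d)⁆)) t :=
    fun b c d => (hF c d).fun_const_smul _
  have hsum : HasDerivAt (fun s => ∑ b, ∑ c, ∑ d,
      (((lc4 a b c d : ℤ) : ℝ) * ⟪x, e b⟫) • curvature (A s) x (e c) (e d))
      (∑ b, ∑ c, ∑ d, (((lc4 a b c d : ℤ) : ℝ) * ⟪x, e b⟫) •
        (∑ i, covDeriv (A t) (fun y => covDeriv (A t) (fun z => curvature (A t) z (e c) (e d)) y
            (e i)) x (e i) +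
          (2 : ℝ) • ∑ i, ⁅curvature (A t) x (e c) (e i), curvature (A t) x (e i) (e d)⁆)) t := by
    refine HasDerivAt.fun_sum fun b _ => ?_
    refine HasDerivAt.fun_sum fun c _ => ?_
    exact HasDerivAt.fun_sum fun d _ => hterm b c d
  have hu : HasDerivAt (fun s => hodgeSec e (A s) a x)
      ((1 / 2 : ℝ) • ∑ b, ∑ c, ∑ d, (((lc4 a b c d : ℤ) : ℝ) * ⟪x, e b⟫) •
        (∑ i, covDeriv (A t) (fun y => covDeriv (A t) (fun z => curvature (A t) z (e c) (e d)) y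
            (e i)) x (e i) +
          (2 : ℝ) • ∑ i, ⁅curvature (A t) x (e c) (e i), curvature (A t) x (e i) (e d)⁆)) t := by
    have h := hsum.fun_const_smul (1 / 2 : ℝ)
    exact h
  refine hu.congr_deriv ?_
  rw [sum_covDeriv_covDeriv_hodgeSec e hA3 a x, hodgeNonlin]
  simp_rw [smul_add, Finset.sum_add_distrib, smul_add]
  congr 1
  rw [Finset.smul_sum]
  refine Finset.sum_congr rfl fun b _ => ?_
  rw [Finset.smul_sum]
  refine Finset.sum_congr rfl fun c _ => ?_
  rw [Finset.smul_sum]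
  refine Finset.sum_congr rfl fun d _ => ?_
  rw [smul_comm _ (2 : ℝ), smul_smul (1 / 2 : ℝ) 2]
  norm_num

end Heat

end Literature.MathematicalPhysics.QuantumLattice
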